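import Summits.ValiantsHypothesis.ValiantsHypothesis.Theses.Depth4
import Literature.Computability.AlgebraicComplexity.DepthReductionProofs

/-!
# Route Depth4 — `Assembly` (stmt-ValiantsHypothesis-11332) and the known crux `Depth4Tavenas`
# (stmt-ValiantsHypothesis-0332)

Two items of route `Depth4` with candidate proofs on file since the route review of 2026-08-15, never
landed (Theorems/ is prover-only): the assembly `Depth4HomFour → ValiantsHypothesis` is the route's own
deciding theorem `closes`; the crux (known) `Depth4Tavenas` — Tavenas' depth reduction of `VP`
families to product-depth `2` with size `(n+2)^{O(√deg)}` — is the tree theorem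
`productDepthCircuitSize_two_le_of_isVPFamily_holds` (Tavenas 2015, discharged in
`DepthReductionProofs.lean`). Honest framing: bookkeeping; nothing here is progress on `VP ≠ VNP`.
-/

set_option linter.dupNamespace false

namespace Summit.ValiantsHypothesis.ValiantsHypothesis.Theorems.Depth4

open Summit.ValiantsHypothesis.ValiantsHypothesis.Theses.Depth4

/-- **Item `Assembly` (stmt-ValiantsHypothesis-11332), PROVED**: `Depth4HomFour → ValiantsHypothesis`,
by the route's deciding theorem `closes`. [folklore] -/
theorem assembly_proof : Assembly :=
  fun h => closes h

/-- **Item `Depth4Tavenas` (stmt-ValiantsHypothesis-0332, crux (known)), PROVED**: Tavenas' reduction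
to product-depth two for `VP` families, the tree theorem
`productDepthCircuitSize_two_le_of_isVPFamily_holds`. [cite: Tavenas2015, Thm. 4] -/
theorem depth4Tavenas_proof : Depth4Tavenas :=
  fun f hf => Literature.Computability.AlgebraicComplexity.productDepthCircuitSize_two_le_of_isVPFamily_holds f hf

end Summit.ValiantsHypothesis.ValiantsHypothesis.Theorems.Depth4
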